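import Summits.Ventures.Crystal3D.Theorems.StickyWulffConstantCoaxialWallLawEndClasses
import HarnessLib

/-!
# Exact end accounting for the word automaton, IX: a moving ball carries ONE state; distinct reached states have distinct, non-co-axial arrival frames

HONEST FRAMING. Part of the venture `Summits/Ventures/Crystal3D` (cell `crystal3d-full`), helper for the crux
`CoaxialWallLaw` (stmt-Ventures-19481) of `route-Ventures-StickyWulffConstant`, REGISTERED line `WallLedgerF`
(planner cf-p1 gen 16), open stub `stub_coaxialTwoSlabAdhesion` (general fillings).  Rung credit only; F-C1 not
moved.  Structural half of the SHARP end multiplicity (memo F-CONSTANT-g6 §3): what the k-fold-top census may assume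
about the reachable ends sitting at one ball.  Abstract class setting of `…WordCore`, with word rigidity (`hrigid`:
classes sharing a `60°` slot triangle are equal) and the glide non-return (`hnoglide`: no class has the slot dozen
mirrored across a GLIDE normal of another class — `word_image_ne_glideMirror`, `…WordNoGlideMirror`, at instantiation).

* `exists_slot_pred_next` — along a crossing normal `m` of `κ`: `d (next κ m) = F κ u' − 2⟪F κ u', m⟫ m` with
  `⟪F κ u', m⟫ = −√(2/3)` (the mirror image of a FAR slot).
* `word_next_notMem_of_twinReading` — at a ball reading as a twin dozen of `(F κ, m)` with `m` crossing, the mirror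
  class `next κ m` carries NO certified state (its predecessor slot is the mirror image of a far slot — empty,
  `twinDozen_mirror_pos_notMem`).
* **`word_state_eq_of_moving`** — the ball of a MOVING state carries exactly one certified state (full shell:
  `word_class_eq_of_full`; twin reading: the only other candidate is the mirrored class — excluded by the previous
  lemma when `m` crosses, by `hnoglide` when `m` is a glide normal).
* **`word_reached_pred_ne`** — two distinct REACHED states (images of moving states) have distinct predecessor
  balls `(f u₁).1 − d (f u₁).2 ≠ (f u₂).1 − d (f u₂).2`.
* **`word_reached_not_coaxial`** — and their arrival frames are NOT co-axial: the slot dozens are neither equal nor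
  mirror images of each other across any unit menu normal (equal ⇒ same class by rigidity; mirror across a crossing
  normal ⇒ the classes are `κ, next κ n`, excluded by `not_mem_pred_next_of_saturated` (`…EndGap`, `KissingGap δ`,
  `δ > 0`, `δ² > 16/3`); mirror across a glide normal ⇒ `hnoglide`).

WHAT THIS IS NOT: not the stub; the census Prop and the assembly are the next bricks; F-C1 not moved.
-/

noncomputable section

namespace Summit.Ventures.Crystal3D.Theorems

open Summit.Ventures.Crystal3D Finset
open Literature.MathematicalPhysics.StatisticalMechanics (fccStacking)
open scoped InnerProductSpace

variable {X : Finset (EuclideanSpace ℝ (Fin 3))}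

section Word

variable {K : Type*} {F : K → (EuclideanSpace ℝ (Fin 3) ≃ₗᵢ[ℝ] EuclideanSpace ℝ (Fin 3))}
  {d : K → EuclideanSpace ℝ (Fin 3)} {next : K → EuclideanSpace ℝ (Fin 3) → K}
  {W : Finset (EuclideanSpace ℝ (Fin 3) × K)}
  {f : EuclideanSpace ℝ (Fin 3) × K → EuclideanSpace ℝ (Fin 3) × K}

/-- **The direction of the mirror class is the mirror image of a far slot.** -/
theorem exists_slot_pred_next
    (hd : ∀ κ, ∃ u ∈ fccSlots, d κ = F κ u)
    (hmirror : ∀ κ (m : EuclideanSpace ℝ (Fin 3)), ‖m‖ = 1 →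
      (∀ w ∈ fccSlots, ⟪F κ w, m⟫_ℝ = 0 ∨ ⟪F κ w, m⟫_ℝ = Real.sqrt (2 / 3) ∨ ⟪F κ w, m⟫_ℝ = -Real.sqrt (2 / 3)) →
      ⟪d κ, m⟫_ℝ = Real.sqrt (2 / 3) → ∀ x, F (next κ m) x = F κ x - (2 * ⟪F κ x, m⟫_ℝ) • m)
    (hdnext : ∀ κ (m : EuclideanSpace ℝ (Fin 3)), ‖m‖ = 1 →
      (∀ w ∈ fccSlots, ⟪F κ w, m⟫_ℝ = 0 ∨ ⟪F κ w, m⟫_ℝ = Real.sqrt (2 / 3) ∨ ⟪F κ w, m⟫_ℝ = -Real.sqrt (2 / 3)) →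
      ⟪d κ, m⟫_ℝ = Real.sqrt (2 / 3) → ⟪d (next κ m), m⟫_ℝ = Real.sqrt (2 / 3))
    {κ : K} {m : EuclideanSpace ℝ (Fin 3)} (hm : ‖m‖ = 1)
    (hmenu : ∀ w ∈ fccSlots, ⟪F κ w, m⟫_ℝ = 0 ∨ ⟪F κ w, m⟫_ℝ = Real.sqrt (2 / 3) ∨ ⟪F κ w, m⟫_ℝ = -Real.sqrt (2 / 3))
    (hdm : ⟪d κ, m⟫_ℝ = Real.sqrt (2 / 3)) :
    ∃ u' ∈ fccSlots, d (next κ m) = F κ u' - (2 * ⟪F κ u', m⟫_ℝ) • m ∧ ⟪F κ u', m⟫_ℝ = -Real.sqrt (2 / 3) := by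
  have mm : ⟪m, m⟫_ℝ = 1 := by rw [real_inner_self_eq_norm_sq, hm, one_pow]
  obtain ⟨u', hu', hdu'⟩ := hd (next κ m)
  have hF' := hmirror κ m hm hmenu hdm
  have hd'm := hdnext κ m hm hmenu hdm
  refine ⟨u', hu', by rw [hdu', hF' u'], ?_⟩
  have h1 : ⟪F (next κ m) u', m⟫_ℝ = -⟪F κ u', m⟫_ℝ := by
    rw [hF' u', inner_sub_left, real_inner_smul_left, mm]; ring
  rw [← hdu', hd'm] at h1; linarith

/-- **At a crossing twin reading the mirror class carries no certified state.** -/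
theorem word_next_notMem_of_twinReading (hX : ∀ p ∈ X, ∀ q ∈ X, p ≠ q → 1 ≤ dist p q)
    (hd : ∀ κ, ∃ u ∈ fccSlots, d κ = F κ u)
    (hmirror : ∀ κ (m : EuclideanSpace ℝ (Fin 3)), ‖m‖ = 1 →
      (∀ w ∈ fccSlots, ⟪F κ w, m⟫_ℝ = 0 ∨ ⟪F κ w, m⟫_ℝ = Real.sqrt (2 / 3) ∨ ⟪F κ w, m⟫_ℝ = -Real.sqrt (2 / 3)) →
      ⟪d κ, m⟫_ℝ = Real.sqrt (2 / 3) → ∀ x, F (next κ m) x = F κ x - (2 * ⟪F κ x, m⟫_ℝ) • m)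
    (hdnext : ∀ κ (m : EuclideanSpace ℝ (Fin 3)), ‖m‖ = 1 →
      (∀ w ∈ fccSlots, ⟪F κ w, m⟫_ℝ = 0 ∨ ⟪F κ w, m⟫_ℝ = Real.sqrt (2 / 3) ∨ ⟪F κ w, m⟫_ℝ = -Real.sqrt (2 / 3)) →
      ⟪d κ, m⟫_ℝ = Real.sqrt (2 / 3) → ⟪d (next κ m), m⟫_ℝ = Real.sqrt (2 / 3))
    (hW : ∀ v, v ∈ W ↔ (v.1 ∈ X ∧
      (∃ a ∈ fccSlots, ∃ a' ∈ fccSlots, ∃ a'' ∈ fccSlots,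
        ⟪a, a'⟫_ℝ = 1 / 2 ∧ ⟪a, a''⟫_ℝ = 1 / 2 ∧ ⟪a', a''⟫_ℝ = 1 / 2 ∧
        v.1 + F v.2 a ∈ X ∧ v.1 + F v.2 a' ∈ X ∧ v.1 + F v.2 a'' ∈ X) ∧
      v.1 - d v.2 ∈ X))
    {p : EuclideanSpace ℝ (Fin 3)} {κ : K} {m : EuclideanSpace ℝ (Fin 3)} (hm : ‖m‖ = 1)
    (hmenu : ∀ w ∈ fccSlots, ⟪F κ w, m⟫_ℝ = 0 ∨ ⟪F κ w, m⟫_ℝ = Real.sqrt (2 / 3) ∨ ⟪F κ w, m⟫_ℝ = -Real.sqrt (2 / 3))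
    (hown : ∀ w ∈ fccSlots, ⟪F κ w, m⟫_ℝ ≤ 0 → p + F κ w ∈ X)
    (hdm : ⟪d κ, m⟫_ℝ = Real.sqrt (2 / 3)) :
    (p, next κ m) ∉ W := by
  intro hv
  have hr : 0 < Real.sqrt (2 / 3) := Real.sqrt_pos.2 (by norm_num)
  obtain ⟨u', hu', hd', hu'm⟩ := exists_slot_pred_next hd hmirror hdnext hm hmenu hdm
  have hback : p - d (next κ m) ∈ X := ((hW _).1 hv).2.2
  have hpos : 0 < ⟪F κ (-u'), m⟫_ℝ := by rw [map_neg, inner_neg_left, hu'm, neg_neg]; exact hr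
  have key := twinDozen_mirror_pos_notMem hX (F κ) hm hmenu hown (neg_mem_fccSlots hu') hpos
  apply key
  have e : p + (F κ (-u') - (2 * ⟪F κ (-u'), m⟫_ℝ) • m) = p - d (next κ m) := by
    rw [hd', map_neg, inner_neg_left]
    module
  rw [e]; exact hback

/-- **The ball of a MOVING state carries exactly one certified state.**  See the module docstring. -/
theorem word_state_eq_of_moving (hX : ∀ p ∈ X, ∀ q ∈ X, p ≠ q → 1 ≤ dist p q)
    (hd : ∀ κ, ∃ u ∈ fccSlots, d κ = F κ u)
    (hmirror : ∀ κ (m : EuclideanSpace ℝ (Fin 3)), ‖m‖ = 1 →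
      (∀ w ∈ fccSlots, ⟪F κ w, m⟫_ℝ = 0 ∨ ⟪F κ w, m⟫_ℝ = Real.sqrt (2 / 3) ∨ ⟪F κ w, m⟫_ℝ = -Real.sqrt (2 / 3)) →
      ⟪d κ, m⟫_ℝ = Real.sqrt (2 / 3) → ∀ x, F (next κ m) x = F κ x - (2 * ⟪F κ x, m⟫_ℝ) • m)
    (hdnext : ∀ κ (m : EuclideanSpace ℝ (Fin 3)), ‖m‖ = 1 →
      (∀ w ∈ fccSlots, ⟪F κ w, m⟫_ℝ = 0 ∨ ⟪F κ w, m⟫_ℝ = Real.sqrt (2 / 3) ∨ ⟪F κ w, m⟫_ℝ = -Real.sqrt (2 / 3)) →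
      ⟪d κ, m⟫_ℝ = Real.sqrt (2 / 3) → ⟪d (next κ m), m⟫_ℝ = Real.sqrt (2 / 3))
    (hW : ∀ v, v ∈ W ↔ (v.1 ∈ X ∧
      (∃ a ∈ fccSlots, ∃ a' ∈ fccSlots, ∃ a'' ∈ fccSlots,
        ⟪a, a'⟫_ℝ = 1 / 2 ∧ ⟪a, a''⟫_ℝ = 1 / 2 ∧ ⟪a', a''⟫_ℝ = 1 / 2 ∧
        v.1 + F v.2 a ∈ X ∧ v.1 + F v.2 a' ∈ X ∧ v.1 + F v.2 a'' ∈ X) ∧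
      v.1 - d v.2 ∈ X))
    (hrigid : ∀ κ₁ κ₂ : K, (∃ a ∈ fccSlots, ∃ a' ∈ fccSlots, ∃ a'' ∈ fccSlots,
        ⟪a, a'⟫_ℝ = 1 / 2 ∧ ⟪a, a''⟫_ℝ = 1 / 2 ∧ ⟪a', a''⟫_ℝ = 1 / 2 ∧
        (∃ w ∈ fccSlots, F κ₂ w = F κ₁ a) ∧ (∃ w ∈ fccSlots, F κ₂ w = F κ₁ a') ∧
        (∃ w ∈ fccSlots, F κ₂ w = F κ₁ a'')) → κ₁ = κ₂)
    (hnoglide : ∀ (κ κ' : K) (m : EuclideanSpace ℝ (Fin 3)), ‖m‖ = 1 →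
      (∀ w ∈ fccSlots, ⟪F κ w, m⟫_ℝ = 0 ∨ ⟪F κ w, m⟫_ℝ = Real.sqrt (2 / 3) ∨ ⟪F κ w, m⟫_ℝ = -Real.sqrt (2 / 3)) →
      ⟪d κ, m⟫_ℝ = 0 →
      (F κ' : EuclideanSpace ℝ (Fin 3) → EuclideanSpace ℝ (Fin 3)) '' ↑fccSlots ≠
        (fun x => F κ x - (2 * ⟪F κ x, m⟫_ℝ) • m) '' ↑fccSlots)
    {u : EuclideanSpace ℝ (Fin 3) × K}
    (hmov : (∀ w ∈ fccSlots, u.1 + F u.2 w ∈ X) ∨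
      ∃ m : EuclideanSpace ℝ (Fin 3), ‖m‖ = 1 ∧
        (∀ w ∈ fccSlots, ⟪F u.2 w, m⟫_ℝ = 0 ∨ ⟪F u.2 w, m⟫_ℝ = Real.sqrt (2 / 3) ∨ ⟪F u.2 w, m⟫_ℝ = -Real.sqrt (2 / 3)) ∧
        (∀ w ∈ fccSlots, ⟪F u.2 w, m⟫_ℝ ≤ 0 → u.1 + F u.2 w ∈ X) ∧
        (∀ w ∈ fccSlots, ⟪F u.2 w, m⟫_ℝ < 0 → u.1 + (F u.2 w - (2 * ⟪F u.2 w, m⟫_ℝ) • m) ∈ X) ∧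
        (∀ w ∈ fccSlots, 0 < ⟪F u.2 w, m⟫_ℝ → u.1 + F u.2 w ∉ X) ∧
        (⟪d u.2, m⟫_ℝ = Real.sqrt (2 / 3) ∨ ⟪d u.2, m⟫_ℝ = 0))
    {v : EuclideanSpace ℝ (Fin 3) × K} (hv : v ∈ W) (hvu : v.1 = u.1) : v = u := by
  refine Prod.ext hvu ?_
  rcases hmov with hfull | ⟨m, hm, hmenu, hown, hmir, -, hdm⟩
  · exact word_class_eq_of_full hX hW hrigid hfull hv hvu
  · rcases word_class_of_twinDozen hX hW hrigid hm hmenu hown hmir hv hvu with h | ⟨a, ha, a', ha', a'', ha'', i1, i2, i3, m1, m2, m3⟩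
    · exact h
    · exfalso
      -- the slot dozen of `F v.2` is the mirrored dozen
      set L : EuclideanSpace ℝ (Fin 3) ≃ₗᵢ[ℝ] EuclideanSpace ℝ (Fin 3) := (F u.2).trans (ℝ ∙ m)ᗮ.reflection with hL
      have hLapp : ∀ x, L x = F u.2 x - (2 * ⟪F u.2 x, m⟫_ℝ) • m := fun x => by
        rw [hL, LinearIsometryEquiv.trans_apply, reflection_unit_apply hm]
      have hIm := image_fccSlots_eq_of_triangle (F v.2) L ha ha' ha'' i1 i2 i3 m1 m2 m3
      have hIm' : (F v.2 : EuclideanSpace ℝ (Fin 3) → EuclideanSpace ℝ (Fin 3)) '' ↑fccSlots =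
          (fun x => F u.2 x - (2 * ⟪F u.2 x, m⟫_ℝ) • m) '' ↑fccSlots := by
        rw [hIm]; exact Set.image_congr fun x _ => hLapp x
      rcases hdm with hdm | hdm
      · -- crossing: the mirrored dozen is the slot dozen of `next κ m`, which carries no state here
        have hF' := hmirror u.2 m hm hmenu hdm
        have hIm2 : (F v.2 : EuclideanSpace ℝ (Fin 3) → EuclideanSpace ℝ (Fin 3)) '' ↑fccSlots =
            (F (next u.2 m) : EuclideanSpace ℝ (Fin 3) → EuclideanSpace ℝ (Fin 3)) '' ↑fccSlots := by
          rw [hIm']; exact Set.image_congr fun x _ => (hF' x).symm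
        have hmem : ∀ {x : EuclideanSpace ℝ (Fin 3)}, x ∈ fccSlots → ∃ w ∈ fccSlots, F (next u.2 m) w = F v.2 x := by
          intro x hx
          have : F v.2 x ∈ (F (next u.2 m) : EuclideanSpace ℝ (Fin 3) → EuclideanSpace ℝ (Fin 3)) '' ↑fccSlots := by
            rw [← hIm2]; exact ⟨x, Finset.mem_coe.2 hx, rfl⟩
          obtain ⟨w, hw, hwe⟩ := this
          exact ⟨w, Finset.mem_coe.1 hw, hwe⟩
        have hκ : v.2 = next u.2 m :=
          hrigid v.2 (next u.2 m) ⟨a, ha, a', ha', a'', ha'', i1, i2, i3, hmem ha, hmem ha', hmem ha''⟩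
        have hvW : (u.1, next u.2 m) ∈ W := by
          have : v = (u.1, next u.2 m) := Prod.ext hvu hκ
          rw [← this]; exact hv
        exact word_next_notMem_of_twinReading hX hd hmirror hdnext hW hm hmenu hown hdm hvW
      · -- glide: excluded by the glide non-return
        exact hnoglide u.2 v.2 m hm hmenu hdm hIm'

/-- **Distinct states reached at one ball have distinct predecessor balls.** -/
theorem word_reached_pred_ne (hX : ∀ p ∈ X, ∀ q ∈ X, p ≠ q → 1 ≤ dist p q)
    (hd : ∀ κ, ∃ u ∈ fccSlots, d κ = F κ u)
    (hdn : ∀ κ, ∃ m : EuclideanSpace ℝ (Fin 3), ‖m‖ = 1 ∧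
      (∀ w ∈ fccSlots, ⟪F κ w, m⟫_ℝ = 0 ∨ ⟪F κ w, m⟫_ℝ = Real.sqrt (2 / 3) ∨ ⟪F κ w, m⟫_ℝ = -Real.sqrt (2 / 3)) ∧
      ⟪d κ, m⟫_ℝ = Real.sqrt (2 / 3))
    (hmirror : ∀ κ (m : EuclideanSpace ℝ (Fin 3)), ‖m‖ = 1 →
      (∀ w ∈ fccSlots, ⟪F κ w, m⟫_ℝ = 0 ∨ ⟪F κ w, m⟫_ℝ = Real.sqrt (2 / 3) ∨ ⟪F κ w, m⟫_ℝ = -Real.sqrt (2 / 3)) →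
      ⟪d κ, m⟫_ℝ = Real.sqrt (2 / 3) → ∀ x, F (next κ m) x = F κ x - (2 * ⟪F κ x, m⟫_ℝ) • m)
    (hdnext : ∀ κ (m : EuclideanSpace ℝ (Fin 3)), ‖m‖ = 1 →
      (∀ w ∈ fccSlots, ⟪F κ w, m⟫_ℝ = 0 ∨ ⟪F κ w, m⟫_ℝ = Real.sqrt (2 / 3) ∨ ⟪F κ w, m⟫_ℝ = -Real.sqrt (2 / 3)) →
      ⟪d κ, m⟫_ℝ = Real.sqrt (2 / 3) → ⟪d (next κ m), m⟫_ℝ = Real.sqrt (2 / 3))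
    (hW : ∀ v, v ∈ W ↔ (v.1 ∈ X ∧
      (∃ a ∈ fccSlots, ∃ a' ∈ fccSlots, ∃ a'' ∈ fccSlots,
        ⟪a, a'⟫_ℝ = 1 / 2 ∧ ⟪a, a''⟫_ℝ = 1 / 2 ∧ ⟪a', a''⟫_ℝ = 1 / 2 ∧
        v.1 + F v.2 a ∈ X ∧ v.1 + F v.2 a' ∈ X ∧ v.1 + F v.2 a'' ∈ X) ∧
      v.1 - d v.2 ∈ X))
    (hf_full : ∀ v ∈ W, (∀ w ∈ fccSlots, v.1 + F v.2 w ∈ X) → f v = (v.1 + d v.2, v.2))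
    (hf_cross : ∀ v ∈ W, ∀ m : EuclideanSpace ℝ (Fin 3), ‖m‖ = 1 →
      (∀ w ∈ fccSlots, ⟪F v.2 w, m⟫_ℝ = 0 ∨ ⟪F v.2 w, m⟫_ℝ = Real.sqrt (2 / 3) ∨ ⟪F v.2 w, m⟫_ℝ = -Real.sqrt (2 / 3)) →
      (∀ w ∈ fccSlots, ⟪F v.2 w, m⟫_ℝ ≤ 0 → v.1 + F v.2 w ∈ X) →
      (∀ w ∈ fccSlots, ⟪F v.2 w, m⟫_ℝ < 0 → v.1 + (F v.2 w - (2 * ⟪F v.2 w, m⟫_ℝ) • m) ∈ X) →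
      (∀ w ∈ fccSlots, 0 < ⟪F v.2 w, m⟫_ℝ → v.1 + F v.2 w ∉ X) →
      ⟪d v.2, m⟫_ℝ = Real.sqrt (2 / 3) → f v = (v.1 + d (next v.2 m), next v.2 m))
    (hf_glide : ∀ v ∈ W, ∀ m : EuclideanSpace ℝ (Fin 3), ‖m‖ = 1 →
      (∀ w ∈ fccSlots, ⟪F v.2 w, m⟫_ℝ = 0 ∨ ⟪F v.2 w, m⟫_ℝ = Real.sqrt (2 / 3) ∨ ⟪F v.2 w, m⟫_ℝ = -Real.sqrt (2 / 3)) →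
      (∀ w ∈ fccSlots, ⟪F v.2 w, m⟫_ℝ ≤ 0 → v.1 + F v.2 w ∈ X) →
      (∀ w ∈ fccSlots, ⟪F v.2 w, m⟫_ℝ < 0 → v.1 + (F v.2 w - (2 * ⟪F v.2 w, m⟫_ℝ) • m) ∈ X) →
      (∀ w ∈ fccSlots, 0 < ⟪F v.2 w, m⟫_ℝ → v.1 + F v.2 w ∉ X) →
      ⟪d v.2, m⟫_ℝ = 0 → f v = (v.1 + d v.2, v.2))
    (hrigid : ∀ κ₁ κ₂ : K, (∃ a ∈ fccSlots, ∃ a' ∈ fccSlots, ∃ a'' ∈ fccSlots,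
        ⟪a, a'⟫_ℝ = 1 / 2 ∧ ⟪a, a''⟫_ℝ = 1 / 2 ∧ ⟪a', a''⟫_ℝ = 1 / 2 ∧
        (∃ w ∈ fccSlots, F κ₂ w = F κ₁ a) ∧ (∃ w ∈ fccSlots, F κ₂ w = F κ₁ a') ∧
        (∃ w ∈ fccSlots, F κ₂ w = F κ₁ a'')) → κ₁ = κ₂)
    (hnoglide : ∀ (κ κ' : K) (m : EuclideanSpace ℝ (Fin 3)), ‖m‖ = 1 →
      (∀ w ∈ fccSlots, ⟪F κ w, m⟫_ℝ = 0 ∨ ⟪F κ w, m⟫_ℝ = Real.sqrt (2 / 3) ∨ ⟪F κ w, m⟫_ℝ = -Real.sqrt (2 / 3)) →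
      ⟪d κ, m⟫_ℝ = 0 →
      (F κ' : EuclideanSpace ℝ (Fin 3) → EuclideanSpace ℝ (Fin 3)) '' ↑fccSlots ≠
        (fun x => F κ x - (2 * ⟪F κ x, m⟫_ℝ) • m) '' ↑fccSlots)
    {u₁ u₂ : EuclideanSpace ℝ (Fin 3) × K} (hu₁ : u₁ ∈ W) (hu₂ : u₂ ∈ W)
    (hm₁ : (∀ w ∈ fccSlots, u₁.1 + F u₁.2 w ∈ X) ∨
      ∃ m : EuclideanSpace ℝ (Fin 3), ‖m‖ = 1 ∧
        (∀ w ∈ fccSlots, ⟪F u₁.2 w, m⟫_ℝ = 0 ∨ ⟪F u₁.2 w, m⟫_ℝ = Real.sqrt (2 / 3) ∨ ⟪F u₁.2 w, m⟫_ℝ = -Real.sqrt (2 / 3)) ∧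
        (∀ w ∈ fccSlots, ⟪F u₁.2 w, m⟫_ℝ ≤ 0 → u₁.1 + F u₁.2 w ∈ X) ∧
        (∀ w ∈ fccSlots, ⟪F u₁.2 w, m⟫_ℝ < 0 → u₁.1 + (F u₁.2 w - (2 * ⟪F u₁.2 w, m⟫_ℝ) • m) ∈ X) ∧
        (∀ w ∈ fccSlots, 0 < ⟪F u₁.2 w, m⟫_ℝ → u₁.1 + F u₁.2 w ∉ X) ∧
        (⟪d u₁.2, m⟫_ℝ = Real.sqrt (2 / 3) ∨ ⟪d u₁.2, m⟫_ℝ = 0))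
    (hm₂ : (∀ w ∈ fccSlots, u₂.1 + F u₂.2 w ∈ X) ∨
      ∃ m : EuclideanSpace ℝ (Fin 3), ‖m‖ = 1 ∧
        (∀ w ∈ fccSlots, ⟪F u₂.2 w, m⟫_ℝ = 0 ∨ ⟪F u₂.2 w, m⟫_ℝ = Real.sqrt (2 / 3) ∨ ⟪F u₂.2 w, m⟫_ℝ = -Real.sqrt (2 / 3)) ∧
        (∀ w ∈ fccSlots, ⟪F u₂.2 w, m⟫_ℝ ≤ 0 → u₂.1 + F u₂.2 w ∈ X) ∧
        (∀ w ∈ fccSlots, ⟪F u₂.2 w, m⟫_ℝ < 0 → u₂.1 + (F u₂.2 w - (2 * ⟪F u₂.2 w, m⟫_ℝ) • m) ∈ X) ∧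
        (∀ w ∈ fccSlots, 0 < ⟪F u₂.2 w, m⟫_ℝ → u₂.1 + F u₂.2 w ∉ X) ∧
        (⟪d u₂.2, m⟫_ℝ = Real.sqrt (2 / 3) ∨ ⟪d u₂.2, m⟫_ℝ = 0))
    (hne : f u₁ ≠ f u₂) :
    (f u₁).1 - d (f u₁).2 ≠ (f u₂).1 - d (f u₂).2 := by
  intro heq
  obtain ⟨-, hback₁, -⟩ := word_move_target hd hdn hmirror hdnext hW hf_full hf_cross hf_glide hu₁ hm₁
  obtain ⟨-, hback₂, -⟩ := word_move_target hd hdn hmirror hdnext hW hf_full hf_cross hf_glide hu₂ hm₂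
  rw [hback₁, hback₂] at heq
  -- same predecessor ball: one state there, so `u₁ = u₂`
  have := word_state_eq_of_moving hX hd hmirror hdnext hW hrigid hnoglide hm₁ hu₂ heq.symm
  exact hne (by rw [this])

open scoped Classical in
/-- **Distinct states reached at one ball have NON-CO-AXIAL arrival frames**: their slot dozens are neither equal nor
mirror images across a unit menu normal.  See the module docstring. -/
theorem word_reached_not_coaxial {δ : ℝ} (hg : KissingGap δ) (hδ0 : 0 < δ) (hδ : 16 / 3 < δ ^ 2)
    (hX : ∀ p ∈ X, ∀ q ∈ X, p ≠ q → 1 ≤ dist p q)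
    (hd : ∀ κ, ∃ u ∈ fccSlots, d κ = F κ u)
    (hdn : ∀ κ, ∃ m : EuclideanSpace ℝ (Fin 3), ‖m‖ = 1 ∧
      (∀ w ∈ fccSlots, ⟪F κ w, m⟫_ℝ = 0 ∨ ⟪F κ w, m⟫_ℝ = Real.sqrt (2 / 3) ∨ ⟪F κ w, m⟫_ℝ = -Real.sqrt (2 / 3)) ∧
      ⟪d κ, m⟫_ℝ = Real.sqrt (2 / 3))
    (hmirror : ∀ κ (m : EuclideanSpace ℝ (Fin 3)), ‖m‖ = 1 →
      (∀ w ∈ fccSlots, ⟪F κ w, m⟫_ℝ = 0 ∨ ⟪F κ w, m⟫_ℝ = Real.sqrt (2 / 3) ∨ ⟪F κ w, m⟫_ℝ = -Real.sqrt (2 / 3)) →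
      ⟪d κ, m⟫_ℝ = Real.sqrt (2 / 3) → ∀ x, F (next κ m) x = F κ x - (2 * ⟪F κ x, m⟫_ℝ) • m)
    (hdnext : ∀ κ (m : EuclideanSpace ℝ (Fin 3)), ‖m‖ = 1 →
      (∀ w ∈ fccSlots, ⟪F κ w, m⟫_ℝ = 0 ∨ ⟪F κ w, m⟫_ℝ = Real.sqrt (2 / 3) ∨ ⟪F κ w, m⟫_ℝ = -Real.sqrt (2 / 3)) →
      ⟪d κ, m⟫_ℝ = Real.sqrt (2 / 3) → ⟪d (next κ m), m⟫_ℝ = Real.sqrt (2 / 3))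
    (hW : ∀ v, v ∈ W ↔ (v.1 ∈ X ∧
      (∃ a ∈ fccSlots, ∃ a' ∈ fccSlots, ∃ a'' ∈ fccSlots,
        ⟪a, a'⟫_ℝ = 1 / 2 ∧ ⟪a, a''⟫_ℝ = 1 / 2 ∧ ⟪a', a''⟫_ℝ = 1 / 2 ∧
        v.1 + F v.2 a ∈ X ∧ v.1 + F v.2 a' ∈ X ∧ v.1 + F v.2 a'' ∈ X) ∧
      v.1 - d v.2 ∈ X))
    (hf_full : ∀ v ∈ W, (∀ w ∈ fccSlots, v.1 + F v.2 w ∈ X) → f v = (v.1 + d v.2, v.2))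
    (hf_cross : ∀ v ∈ W, ∀ m : EuclideanSpace ℝ (Fin 3), ‖m‖ = 1 →
      (∀ w ∈ fccSlots, ⟪F v.2 w, m⟫_ℝ = 0 ∨ ⟪F v.2 w, m⟫_ℝ = Real.sqrt (2 / 3) ∨ ⟪F v.2 w, m⟫_ℝ = -Real.sqrt (2 / 3)) →
      (∀ w ∈ fccSlots, ⟪F v.2 w, m⟫_ℝ ≤ 0 → v.1 + F v.2 w ∈ X) →
      (∀ w ∈ fccSlots, ⟪F v.2 w, m⟫_ℝ < 0 → v.1 + (F v.2 w - (2 * ⟪F v.2 w, m⟫_ℝ) • m) ∈ X) →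
      (∀ w ∈ fccSlots, 0 < ⟪F v.2 w, m⟫_ℝ → v.1 + F v.2 w ∉ X) →
      ⟪d v.2, m⟫_ℝ = Real.sqrt (2 / 3) → f v = (v.1 + d (next v.2 m), next v.2 m))
    (hf_glide : ∀ v ∈ W, ∀ m : EuclideanSpace ℝ (Fin 3), ‖m‖ = 1 →
      (∀ w ∈ fccSlots, ⟪F v.2 w, m⟫_ℝ = 0 ∨ ⟪F v.2 w, m⟫_ℝ = Real.sqrt (2 / 3) ∨ ⟪F v.2 w, m⟫_ℝ = -Real.sqrt (2 / 3)) →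
      (∀ w ∈ fccSlots, ⟪F v.2 w, m⟫_ℝ ≤ 0 → v.1 + F v.2 w ∈ X) →
      (∀ w ∈ fccSlots, ⟪F v.2 w, m⟫_ℝ < 0 → v.1 + (F v.2 w - (2 * ⟪F v.2 w, m⟫_ℝ) • m) ∈ X) →
      (∀ w ∈ fccSlots, 0 < ⟪F v.2 w, m⟫_ℝ → v.1 + F v.2 w ∉ X) →
      ⟪d v.2, m⟫_ℝ = 0 → f v = (v.1 + d v.2, v.2))
    (hrigid : ∀ κ₁ κ₂ : K, (∃ a ∈ fccSlots, ∃ a' ∈ fccSlots, ∃ a'' ∈ fccSlots,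
        ⟪a, a'⟫_ℝ = 1 / 2 ∧ ⟪a, a''⟫_ℝ = 1 / 2 ∧ ⟪a', a''⟫_ℝ = 1 / 2 ∧
        (∃ w ∈ fccSlots, F κ₂ w = F κ₁ a) ∧ (∃ w ∈ fccSlots, F κ₂ w = F κ₁ a') ∧
        (∃ w ∈ fccSlots, F κ₂ w = F κ₁ a'')) → κ₁ = κ₂)
    (hnoglide : ∀ (κ κ' : K) (m : EuclideanSpace ℝ (Fin 3)), ‖m‖ = 1 →
      (∀ w ∈ fccSlots, ⟪F κ w, m⟫_ℝ = 0 ∨ ⟪F κ w, m⟫_ℝ = Real.sqrt (2 / 3) ∨ ⟪F κ w, m⟫_ℝ = -Real.sqrt (2 / 3)) →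
      ⟪d κ, m⟫_ℝ = 0 →
      (F κ' : EuclideanSpace ℝ (Fin 3) → EuclideanSpace ℝ (Fin 3)) '' ↑fccSlots ≠
        (fun x => F κ x - (2 * ⟪F κ x, m⟫_ℝ) • m) '' ↑fccSlots)
    {u₁ : EuclideanSpace ℝ (Fin 3) × K} (hu₁ : u₁ ∈ W)
    (hm₁ : (∀ w ∈ fccSlots, u₁.1 + F u₁.2 w ∈ X) ∨
      ∃ m : EuclideanSpace ℝ (Fin 3), ‖m‖ = 1 ∧
        (∀ w ∈ fccSlots, ⟪F u₁.2 w, m⟫_ℝ = 0 ∨ ⟪F u₁.2 w, m⟫_ℝ = Real.sqrt (2 / 3) ∨ ⟪F u₁.2 w, m⟫_ℝ = -Real.sqrt (2 / 3)) ∧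
        (∀ w ∈ fccSlots, ⟪F u₁.2 w, m⟫_ℝ ≤ 0 → u₁.1 + F u₁.2 w ∈ X) ∧
        (∀ w ∈ fccSlots, ⟪F u₁.2 w, m⟫_ℝ < 0 → u₁.1 + (F u₁.2 w - (2 * ⟪F u₁.2 w, m⟫_ℝ) • m) ∈ X) ∧
        (∀ w ∈ fccSlots, 0 < ⟪F u₁.2 w, m⟫_ℝ → u₁.1 + F u₁.2 w ∉ X) ∧
        (⟪d u₁.2, m⟫_ℝ = Real.sqrt (2 / 3) ∨ ⟪d u₁.2, m⟫_ℝ = 0))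
    {v₂ : EuclideanSpace ℝ (Fin 3) × K} (hv₂ : v₂ ∈ W) (hb : v₂.1 = (f u₁).1) (hne : v₂ ≠ f u₁) :
    (F v₂.2 : EuclideanSpace ℝ (Fin 3) → EuclideanSpace ℝ (Fin 3)) '' ↑fccSlots ≠
        (F (f u₁).2 : EuclideanSpace ℝ (Fin 3) → EuclideanSpace ℝ (Fin 3)) '' ↑fccSlots ∧
      ∀ n : EuclideanSpace ℝ (Fin 3), ‖n‖ = 1 →
        (∀ w ∈ fccSlots, ⟪F (f u₁).2 w, n⟫_ℝ = 0 ∨ ⟪F (f u₁).2 w, n⟫_ℝ = Real.sqrt (2 / 3) ∨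
          ⟪F (f u₁).2 w, n⟫_ℝ = -Real.sqrt (2 / 3)) →
        (F v₂.2 : EuclideanSpace ℝ (Fin 3) → EuclideanSpace ℝ (Fin 3)) '' ↑fccSlots ≠
          (fun x => F (f u₁).2 x - (2 * ⟪F (f u₁).2 x, n⟫_ℝ) • n) '' ↑fccSlots := by
  have hr : 0 < Real.sqrt (2 / 3) := Real.sqrt_pos.2 (by norm_num)
  set v₁ := f u₁ with hv₁
  obtain ⟨hv₁W, hback₁, -⟩ := word_move_target hd hdn hmirror hdnext hW hf_full hf_cross hf_glide hu₁ hm₁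
  -- the predecessor of `v₁` is the (saturated) ball of `u₁`; the predecessor of `v₂` is a ball
  have hsat : (X.filter fun q => dist (v₁.1 - d v₁.2) q = 1).card = 12 := by
    rw [hback₁]; exact word_moving_saturated hX hm₁
  have hpred₁ : v₁.1 - d v₁.2 ∈ X := by rw [hback₁]; exact ((hW u₁).1 hu₁).1
  have hpred₂ : v₂.1 - d v₂.2 ∈ X := ((hW v₂).1 hv₂).2.2
  obtain ⟨-, ⟨a, ha, a', ha', a'', ha'', i1, i2, i3, -, -, -⟩, -⟩ := (hW v₂).1 hv₂
  -- a slot-image equality transfers the triangle of `v₂.2` into the other frame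
  have htri : ∀ (G : EuclideanSpace ℝ (Fin 3) → EuclideanSpace ℝ (Fin 3)),
      (F v₂.2 : EuclideanSpace ℝ (Fin 3) → EuclideanSpace ℝ (Fin 3)) '' ↑fccSlots = G '' ↑fccSlots →
      ∀ {x : EuclideanSpace ℝ (Fin 3)}, x ∈ fccSlots → ∃ w ∈ fccSlots, G w = F v₂.2 x := by
    intro G hG x hx
    have : F v₂.2 x ∈ G '' ↑fccSlots := by rw [← hG]; exact ⟨x, Finset.mem_coe.2 hx, rfl⟩
    obtain ⟨w, hw, hwe⟩ := this
    exact ⟨w, Finset.mem_coe.1 hw, hwe⟩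
  refine ⟨?_, ?_⟩
  · -- equal slot dozens ⇒ equal classes ⇒ equal states
    intro hEq
    have hκ : v₂.2 = v₁.2 :=
      hrigid v₂.2 v₁.2 ⟨a, ha, a', ha', a'', ha'', i1, i2, i3, htri _ hEq ha, htri _ hEq ha', htri _ hEq ha''⟩
    exact hne (Prod.ext hb hκ)
  · -- mirror images across a menu normal `n`
    -- the crossing case, for a normal `n` with `⟪d v₁.2, n⟫ = +√(2/3)`
    have hcross : ∀ n : EuclideanSpace ℝ (Fin 3), ‖n‖ = 1 →
        (∀ w ∈ fccSlots, ⟪F v₁.2 w, n⟫_ℝ = 0 ∨ ⟪F v₁.2 w, n⟫_ℝ = Real.sqrt (2 / 3) ∨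
          ⟪F v₁.2 w, n⟫_ℝ = -Real.sqrt (2 / 3)) →
        ⟪d v₁.2, n⟫_ℝ = Real.sqrt (2 / 3) →
        (F v₂.2 : EuclideanSpace ℝ (Fin 3) → EuclideanSpace ℝ (Fin 3)) '' ↑fccSlots ≠
          (fun x => F v₁.2 x - (2 * ⟪F v₁.2 x, n⟫_ℝ) • n) '' ↑fccSlots := by
      intro n hn hmenu hdn' hEq
      have hF' := hmirror v₁.2 n hn hmenu hdn'
      have hEq' : (F v₂.2 : EuclideanSpace ℝ (Fin 3) → EuclideanSpace ℝ (Fin 3)) '' ↑fccSlots =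
          (F (next v₁.2 n) : EuclideanSpace ℝ (Fin 3) → EuclideanSpace ℝ (Fin 3)) '' ↑fccSlots := by
        rw [hEq]; exact Set.image_congr fun x _ => (hF' x).symm
      have hκ : v₂.2 = next v₁.2 n :=
        hrigid v₂.2 (next v₁.2 n) ⟨a, ha, a', ha', a'', ha'', i1, i2, i3, htri _ hEq' ha, htri _ hEq' ha',
          htri _ hEq' ha''⟩
      have hmem : v₁.1 - d (next v₁.2 n) ∈ X := by rw [← hκ, ← hb]; exact hpred₂
      exact not_mem_pred_next_of_saturated hg hδ0 hδ hX hd hmirror hdnext hn hmenu hdn' hpred₁ hsat hmem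
    intro n hn hmenu
    obtain ⟨u, hu, hdu⟩ := hd v₁.2
    rcases hmenu u hu with h0 | hp | hneg
    · -- glide normal
      exact hnoglide v₁.2 v₂.2 n hn hmenu (by rw [hdu]; exact h0)
    · exact hcross n hn hmenu (by rw [hdu]; exact hp)
    · -- `⟪d, n⟫ = −√(2/3)`: use `−n`, the same mirror
      have hn' : ‖-n‖ = 1 := by rw [norm_neg, hn]
      have hmenu' : ∀ w ∈ fccSlots, ⟪F v₁.2 w, -n⟫_ℝ = 0 ∨ ⟪F v₁.2 w, -n⟫_ℝ = Real.sqrt (2 / 3) ∨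
          ⟪F v₁.2 w, -n⟫_ℝ = -Real.sqrt (2 / 3) := by
        intro w hw
        rw [inner_neg_right]
        rcases hmenu w hw with h | h | h
        · exact Or.inl (by rw [h, neg_zero])
        · exact Or.inr (Or.inr (by rw [h]))
        · exact Or.inr (Or.inl (by rw [h, neg_neg]))
      have hdn' : ⟪d v₁.2, -n⟫_ℝ = Real.sqrt (2 / 3) := by rw [inner_neg_right, hdu, hneg, neg_neg]
      have key := hcross (-n) hn' hmenu' hdn'
      have e : (fun x => F v₁.2 x - (2 * ⟪F v₁.2 x, -n⟫_ℝ) • (-n)) =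
          (fun x => F v₁.2 x - (2 * ⟪F v₁.2 x, n⟫_ℝ) • n) := by
        funext x; rw [inner_neg_right, smul_neg, mul_neg, neg_smul, neg_neg]
      rw [e] at key; exact key

end Word

end Summit.Ventures.Crystal3D.Theorems

end
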